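import Literature.NumberTheory.GaloisRepresentations.LocalEulerCharacteristicMu
import Literature.NumberTheory.GaloisRepresentations.LocalDualityTheorem
import Literature.NumberTheory.GaloisRepresentations.LocalDualityTwoZero
import Literature.NumberTheory.GaloisRepresentations.DualityLineTwo
import Literature.NumberTheory.GaloisRepresentations.CyclicIndexEulerChar
import HarnessLib

/-!
# Tate's local Euler–Poincaré characteristic formula for `ℤ/pℤ` over `K_v`, and invariance under isomorphism

Topic `NumberTheory/GaloisRepresentations`; namespace `Literature.NumberTheory.GaloisRepresentations`.
Theorems only (no definition, no named fact; D-0026).  Sequel to `LocalEulerCharacteristicMu.lean`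
(the case `M = μ_n` of the tree's named fact `localEulerPoincareCharacteristic`, Milne *ADT* I
Thm. 2.8) and `LocalEulerCharacteristicDevissage.lean` (multiplicativity in short exact sequences).

* `localEulerPoincare_of_iso` — the conclusion of `localEulerPoincareCharacteristic F` for a module
  `M` passes to any module `M'` with `M ≅ M'` as topological `Γ_F`-representations (all four counts
  `#M`, `#M^Γ`, `#H¹`, `#H²` are invariants of the isomorphism class).
* `localEulerPoincareCharacteristic_trivial_prime_adicCompletion` — **the formula for a TRIVIAL
  `Γ_{K_v}`-module `M` of prime order `p`** (i.e. `M ≅ ℤ/pℤ`) over the completion `K_v` of a number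
  field: `#M^Γ · #H²(K_v, M) · #(𝒪/p) = #H¹(K_v, M)`.  As in Serre's proof (II §5.7, Lemme 5:
  "`H¹(L, ℤ/pℤ)` = dual de `L*/L*ᵖ` … `H²(L, ℤ/pℤ)` = dual de `H⁰(L, μ_p)` (théorème de dualité)"),
  from the tree's PROVED local Tate duality: `#H¹(K_v, M) = #H¹(K_v, M^D)` (`localDuality_bijective`,
  degree `1`) and `#H²(K_v, M) = #(M^D)^Γ` (`natCard_two_eq_natCard_invariants_homRep`, bidegree
  `(2,0)`), where `M^D = Hom(M, μ_p) ≅ μ_p` (`lineHomIso`), together with the case `μ_p`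
  (`localEulerPoincareCharacteristic_mu_adicCompletion`).

With `LocalEulerCharacteristicDevissage.localEulerPoincare_of_isSES` these give the formula for every
finite `p`-primary `Γ_{K_v}`-module admitting a filtration with graded pieces isomorphic to `ℤ/pℤ` or
`μ_p` (e.g. `E[p^k]` for an elliptic curve with split multiplicative reduction at `v ∣ p`).

## References
* J. S. Milne, *Arithmetic Duality Theorems*, 2nd ed. (2006), I Cor. 2.3, Thm. 2.8. [MilneADT2006]
* J.-P. Serre, *Galois Cohomology* (1997), II §5.2 Thm. 2, §5.7 Thm. 5 and Lemme 5. [SerreGaloisCohomology1997]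
-/

noncomputable section

open CategoryTheory Function
open Field IsNonarchimedeanLocalField

universe u

namespace Literature.NumberTheory.GaloisRepresentations

open _root_.TopRep _root_.ContRepresentation _root_.ContinuousCohomology DiscreteGaloisModule
open LocalWeilDatum NumberField IsDedekindDomain

/-! ### Invariance under isomorphism -/

section Iso

open ValuativeRel

variable (F : Type u) [Field F] [ValuativeRel F]
variable {M : Type u} [AddCommGroup M] [TopologicalSpace M] [DiscreteTopology M]
variable {M' : Type u} [AddCommGroup M'] [TopologicalSpace M'] [DiscreteTopology M']
variable {ρ : ContinuousRep (absoluteGaloisGroup F) ℤ M} {ρ' : ContinuousRep (absoluteGaloisGroup F) ℤ M'}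

omit [ValuativeRel F] in
/-- The carriers of isomorphic topological representations are in bijection. [folklore] -/
private theorem natCard_eq_of_iso (e : ρ.toTopRep ≅ ρ'.toTopRep) : Nat.card M = Nat.card M' :=
  Nat.card_congr
    { toFun := fun m => e.hom.hom m
      invFun := fun m' => e.inv.hom m'
      left_inv := fun m => by
        change e.inv.hom (e.hom.hom m) = m
        rw [← TopRep.comp_apply, e.hom_inv_id, TopRep.id_apply]
      right_inv := fun m' => by
        change e.hom.hom (e.inv.hom m') = m'
        rw [← TopRep.comp_apply, e.inv_hom_id, TopRep.id_apply] }

/-- **The local Euler–Poincaré characteristic formula is invariant under isomorphism** (stated for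
any field `F` with a valuative relation, `𝒪[F]` its valuation ring): if
`M ≅ M'` as topological `Γ_F`-representations and `#M^Γ · #H²(F, M) · #(𝒪[F]/(#M)) = #H¹(F, M)` with
`H¹(F, M)`, `H²(F, M)` finite, then the same holds for `M'` (`#M`, `#M^Γ`, `#Hⁱ` are transported along
the isomorphism: `invariantsEquivOfIso`, `continuousCohomologyEquivOfIso`).
[cite: MilneADT2006, Ch. I §2, Thm. 2.8] -/
theorem localEulerPoincare_of_iso (e : ρ.toTopRep ≅ ρ'.toTopRep)
    (h : Finite (continuousCohomology 1 ρ.toTopRep) ∧ Finite (continuousCohomology 2 ρ.toTopRep) ∧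
      Nat.card ρ.toTopRep.ρ.invariants * Nat.card (continuousCohomology 2 ρ.toTopRep) *
          Nat.card (𝒪[F] ⧸ Ideal.span {((Nat.card M : ℕ) : 𝒪[F])}) =
        Nat.card (continuousCohomology 1 ρ.toTopRep)) :
    Finite (continuousCohomology 1 ρ'.toTopRep) ∧ Finite (continuousCohomology 2 ρ'.toTopRep) ∧
      Nat.card ρ'.toTopRep.ρ.invariants * Nat.card (continuousCohomology 2 ρ'.toTopRep) *
          Nat.card (𝒪[F] ⧸ Ideal.span {((Nat.card M' : ℕ) : 𝒪[F])}) =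
        Nat.card (continuousCohomology 1 ρ'.toTopRep) := by
  obtain ⟨h1, h2, h⟩ := h
  refine ⟨Finite.of_equiv _ (continuousCohomologyEquivOfIso e 1),
    Finite.of_equiv _ (continuousCohomologyEquivOfIso e 2), ?_⟩
  rw [← natCard_eq_of_iso F e, ← Nat.card_congr (invariantsEquivOfIso e),
    ← natCard_continuousCohomology_eq_of_iso e 1, ← natCard_continuousCohomology_eq_of_iso e 2]
  exact h

end Iso

/-! ### The trivial module of prime order over `K_v` -/

section Trivial

open ValuativeRel

variable (K : Type u) [Field K] [NumberField K] (v : HeightOneSpectrum (𝓞 K))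
variable {M : Type u} [AddCommGroup M] [TopologicalSpace M] [DiscreteTopology M] [Finite M]

/-- **Tate's local Euler–Poincaré characteristic formula for `ℤ/pℤ` over `K_v`** (Milne I Thm. 2.8
for a trivial `Γ_{K_v}`-module `M` of prime order `p`): `H¹(K_v, M)`, `H²(K_v, M)` are finite and
`#M^Γ · #H²(K_v, M) · #(𝒪[K_v]/(#M)) = #H¹(K_v, M)`.  Proof (Serre II §5.7, Lemme 5): by local Tate
duality `#H¹(K_v, M) = #H¹(K_v, M^D)` (`localDuality_bijective`) and `#H²(K_v, M) = #(M^D)^Γ`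
(`natCard_two_eq_natCard_invariants_homRep`) with `M^D = Hom(M, μ_p) ≅ μ_p` (`lineHomIso`), and the
formula for `μ_p` (`localEulerPoincareCharacteristic_mu_adicCompletion`) reads
`#μ_p^Γ · p · #(𝒪/p) = #H¹(K_v, μ_p)`; as `#M^Γ = #M = p`, both sides for `M` equal
`p · #μ_p(K̄_v)^Γ · #(𝒪/p)`. [cite: MilneADT2006, Ch. I §2, Thm. 2.8 (p. 31)]
[cite: SerreGaloisCohomology1997, II §5.7 Thm. 5, Lemme 5] -/
theorem localEulerPoincareCharacteristic_trivial_prime_adicCompletion {p : ℕ} [hp : Fact p.Prime]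
    (ρ : ContinuousRep (absoluteGaloisGroup (v.adicCompletion K)) ℤ M) (hM : Nat.card M = p)
    (hρ : ∀ (σ : absoluteGaloisGroup (v.adicCompletion K)) (m : M), ρ σ m = m) :
    Finite (continuousCohomology 1 ρ.toTopRep) ∧ Finite (continuousCohomology 2 ρ.toTopRep) ∧
      Nat.card ρ.toTopRep.ρ.invariants * Nat.card (continuousCohomology 2 ρ.toTopRep) *
          Nat.card (𝒪[v.adicCompletion K] ⧸
            Ideal.span {((Nat.card M : ℕ) : 𝒪[v.adicCompletion K])}) =
        Nat.card (continuousCohomology 1 ρ.toTopRep) := by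
  classical
  -- notation and instances
  haveI : CharZero (v.adicCompletion K) :=
    charZero_of_injective_algebraMap (algebraMap K _).injective
  haveI := absoluteGaloisGroup_compactSpace (v.adicCompletion K)
  haveI hn1 : NeZero (p ^ 1) := ⟨pow_ne_zero _ hp.out.ne_zero⟩
  haveI : Finite (MuCarrier (v.adicCompletion K) (p ^ 1)) := finite_muCarrier (v.adicCompletion K) (p ^ 1)
  have hp1 : p ^ 1 = p := pow_one p
  have hMp : ∀ m : M, p • m = 0 := ContinuousRep.card_nsmul_eq_zero_of_card hM
  have hMp1 : ∀ m : M, p ^ 1 • m = 0 := fun m => by rw [hp1]; exact hMp m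
  -- the coefficient module `μ = μ_{p^1}` and its counts
  have hμcard : Nat.card (MuCarrier (v.adicCompletion K) (p ^ 1)) = p := by
    change Nat.card (rootsOfUnity (p ^ 1) (AlgebraicClosure (v.adicCompletion K))) = p
    rw [HasEnoughRootsOfUnity.natCard_rootsOfUnity _ (p ^ 1), hp1]
  have hμp : ∀ x : MuCarrier (v.adicCompletion K) (p ^ 1), p • x = 0 :=
    ContinuousRep.card_nsmul_eq_zero_of_card hμcard
  obtain ⟨hμ1, hμ2, hμ⟩ := localEulerPoincareCharacteristic_mu_adicCompletion K v (p ^ 1)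
  have hμH2 : Nat.card (continuousCohomology 2 (mu (v.adicCompletion K) (p ^ 1)).toTopRep) = p := by
    have hbot : ∀ g : absoluteGaloisGroup (v.adicCompletion K),
        g ∈ galFixing (v.adicCompletion K)
          (⊥ : IntermediateField (v.adicCompletion K) (AlgebraicClosure (v.adicCompletion K))) :=
      fun g => by
        rw [galFixing_bot]
        trivial
    rw [(Nat.card_congr (resHEquivOfTop (mu (v.adicCompletion K) (p ^ 1)) _ hbot 2).toEquiv).trans
      (natCard_two_mu_eq (v.adicCompletion K) ⊥ (p ^ 1)), hp1]
  -- `M^D = Hom(M, μ) ≅ μ[p] = μ`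
  obtain ⟨w₀, hw₀⟩ := ContinuousRep.exists_ne_zero_of_card hM
  let eD := ContinuousRep.lineHomIso ρ (mu (v.adicCompletion K) (p ^ 1)) hρ hM hw₀
  have htop : Submodule.torsionBy ℤ (MuCarrier (v.adicCompletion K) (p ^ 1)) (p : ℤ) = ⊤ := by
    rw [eq_top_iff]
    intro x _
    exact (ContinuousRep.mem_torsionBy_nsmul_iff p).2 (hμp x)
  let eT : ((mu (v.adicCompletion K) (p ^ 1)).torsionRep p).toTopRep ≅
      (mu (v.adicCompletion K) (p ^ 1)).toTopRep :=
    topRepIsoOfEquiv (X := ((mu (v.adicCompletion K) (p ^ 1)).torsionRep p).toTopRep)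
      (Y := (mu (v.adicCompletion K) (p ^ 1)).toTopRep)
      { ((LinearEquiv.ofEq _ _ htop).trans (Submodule.topEquiv)) with
        continuous_toFun := continuous_of_discreteTopology
        continuous_invFun := continuous_of_discreteTopology }
      (fun g x => rfl)
  let e := eD ≪≫ eT
  -- `#H²(K_v, M) = #(M^D)^Γ = #μ^Γ`
  obtain ⟨hfin2, h2⟩ := natCard_two_eq_natCard_invariants_homRep (v.adicCompletion K) ρ hMp1
  have h2' : Nat.card (continuousCohomology 2 ρ.toTopRep) =
      Nat.card (mu (v.adicCompletion K) (p ^ 1)).toTopRep.ρ.invariants := by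
    rw [h2]
    exact Nat.card_congr (invariantsEquivOfIso e)
  -- `#H¹(K_v, M) = #H¹(K_v, M^D) = #H¹(K_v, μ)`
  haveI hfin1 : Finite (continuousCohomology 1 ρ.toTopRep) :=
    finite_galoisCohomology_one_of_isNonarchimedeanLocalField ρ
  haveI : Finite (continuousCohomology 1 (ρ.homRep (mu (v.adicCompletion K) (p ^ 1))).toTopRep) :=
    finite_galoisCohomology_one_of_isNonarchimedeanLocalField _
  have hD : ∀ f : HomCarrier M (MuCarrier (v.adicCompletion K) (p ^ 1)), p ^ 1 • f = 0 :=
    fun f => HomCarrier.nsmul_eq_zero_of_left hMp1 f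
  have hB : ∀ b : continuousCohomology 1 (ρ.homRep (mu (v.adicCompletion K) (p ^ 1))).toTopRep,
      p ^ 1 • b = 0 := nsmul_continuousCohomology_one_eq_zero _ (p ^ 1) hD
  obtain ⟨ι, -, hbij, -⟩ := localDuality_bijective (v.adicCompletion K) ρ hMp1
  have h1 : Nat.card (continuousCohomology 1 ρ.toTopRep) =
      Nat.card (continuousCohomology 1 (mu (v.adicCompletion K) (p ^ 1)).toTopRep) := by
    rw [Nat.card_congr (Equiv.ofBijective _ hbij), Nat.card_addMonoidHom_zmod hB]
    exact natCard_continuousCohomology_eq_of_iso e 1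
  -- `#M^Γ = #M = p`
  have h0 : Nat.card ρ.toTopRep.ρ.invariants = p := by
    rw [← hM]
    symm
    refine Nat.card_congr
      { toFun := fun m => ⟨m, fun σ => hρ σ m⟩
        invFun := fun w => w.1
        left_inv := fun m => rfl
        right_inv := fun w => rfl }
  refine ⟨hfin1, hfin2, ?_⟩
  -- assemble: both sides are `p · #μ^Γ · #(𝒪/p)`
  rw [h0, h2', h1, ← hμ, hμcard, hμH2, hM]
  ring

end Trivial

end Literature.NumberTheory.GaloisRepresentations

end
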